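import Mathlib
import Literature.Computability.AlgebraicComplexity.GroupTheoreticMatMul
import Summits.MatrixMultiplication.MatrixMultiplication.Theorems.ThinPackings.Negative.TriageRuledGraphPatternedArc

/-!
# drefute evidence — `stub_deborderingPower` is TRUE (sorry-free proof of the registered signature)

Crux `ThinPackings` (stmt-MatrixMultiplication-10595), line `label-weighted-stpp-debordering`,
registered stub `stub_deborderingPower` (skeleton sha ca8354006f96…): DE-BORDERING, finite core — for a
label-weighted family of `L` blocks `⟨N, M, N⟩` with potentials in `[-R, R]` and every `n`, the product blocks
`A_w = ∏ₜ A (w t)` of the most popular weight-sum class `(Σₜ κ (w t), Σₜ μ (w t)) = (p, q)` form a genuine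
`IsSTPP` family in `Fin n → H` of `L' ≥ Lⁿ/(2nR+1)²` blocks `⟨Nⁿ, Mⁿ, Nⁿ⟩`.
Proof: a relation among three words of the class holds coordinatewise; a coordinate with all three labels equal
has weight `0`, any other has weight `≥ 1` (clause (5)); the total weight is `(p − p) + (q − q) = 0`, so every
coordinate is diagonal, the three words coincide, and clause (4) finishes coordinatewise.
Refuter seat refuter-drefute-stmt-MatrixMultiplication-10595-0, 2026-08-16 (positive lemma; candidate proof for the
lead, not landed by the refuter).
-/

set_option linter.dupNamespace false

namespace Summit.MatrixMultiplication.MatrixMultiplication.Cruxes.ThinPackings.Drefute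

open Finset
open Literature.Computability.AlgebraicComplexity (IsSTPP)
open Summit.MatrixMultiplication.MatrixMultiplication.Theorems.ThinPackings.Negative.Triage2
  (IsLabelWeightedSTPP)

/-- Registered signature of `stub_deborderingPower`, verbatim. -/
def DeborderingPowerReg : Prop :=
  ∀ (H : Type) [AddCommGroup H] (L N M R : ℕ) (A B C : Fin L → Finset H) (κ μ : Fin L → ℤ), IsLabelWeightedSTPP A B C κ μ → (∀ i, (A i).card = N ∧ (B i).card = M ∧ (C i).card = N) → (∀ i, |κ i| ≤ R ∧ |μ i| ≤ R) → ∀ n : ℕ, ∃ (L' : ℕ) (A' B' C' : Fin L' → Finset (Fin n → H)), IsSTPP A' B' C' ∧ (∀ i, (A' i).card = N ^ n ∧ (B' i).card = M ^ n ∧ (C' i).card = N ^ n) ∧ L ^ n ≤ L' * (2 * n * R + 1) ^ 2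

/-- Cardinality of the integer interval `[-K, K]`. -/
theorem card_Icc_neg_self (K : ℕ) : (Finset.Icc (-(K : ℤ)) K).card = 2 * K + 1 := by
  rw [Int.card_Icc]
  have : (K : ℤ) + 1 - -(K : ℤ) = ((2 * K + 1 : ℕ) : ℤ) := by push_cast; ring
  rw [this]
  rfl

/-- **`stub_deborderingPower` holds.** -/
theorem deborderingPower : DeborderingPowerReg := by
  intro H _ L N M R A B C κ μ hW hc hR n
  classical
  obtain ⟨-, -, -, h4, h5⟩ := hW
  -- the class map and its range
  let cls : (Fin n → Fin L) → ℤ × ℤ := fun w => (∑ t, κ (w t), ∑ t, μ (w t))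
  let I : Finset ℤ := Finset.Icc (-((n * R : ℕ) : ℤ)) ((n * R : ℕ) : ℤ)
  let S : Finset (ℤ × ℤ) := I ×ˢ I
  have hbound_sum : ∀ (f : Fin L → ℤ), (∀ i, |f i| ≤ R) → ∀ w : Fin n → Fin L,
      (∑ t, f (w t)) ∈ I := by
    intro f hf w
    have hlo : ∀ t, -(R : ℤ) ≤ f (w t) := fun t => (abs_le.1 (hf (w t))).1
    have hhi : ∀ t, f (w t) ≤ R := fun t => (abs_le.1 (hf (w t))).2
    simp only [I, Finset.mem_Icc]
    constructor
    · calc -((n * R : ℕ) : ℤ) = ∑ _t : Fin n, (-(R : ℤ)) := by simp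
        _ ≤ ∑ t, f (w t) := Finset.sum_le_sum fun t _ => hlo t
    · calc ∑ t, f (w t) ≤ ∑ _t : Fin n, (R : ℤ) := Finset.sum_le_sum fun t _ => hhi t
        _ = ((n * R : ℕ) : ℤ) := by simp
  have hmaps : ∀ w : Fin n → Fin L, cls w ∈ S := by
    intro w
    simp only [cls, S, Finset.mem_product]
    exact ⟨hbound_sum κ (fun i => (hR i).1) w, hbound_sum μ (fun i => (hR i).2) w⟩
  have h0I : (0 : ℤ) ∈ I := by
    simp only [I, Finset.mem_Icc]
    exact ⟨neg_nonpos.2 (by positivity), by positivity⟩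
  have hSne : S.Nonempty := ⟨(0, 0), Finset.mem_product.2 ⟨h0I, h0I⟩⟩
  -- fibres of the class map and the most popular class
  let fib : ℤ × ℤ → Finset (Fin n → Fin L) := fun c => Finset.univ.filter fun w => cls w = c
  obtain ⟨c, -, hcmax⟩ := Finset.exists_max_image S (fun c => (fib c).card) hSne
  have hIcard : I.card = 2 * n * R + 1 := by
    have := card_Icc_neg_self (n * R)
    simpa [I, mul_assoc] using this
  have hScard : S.card = (2 * n * R + 1) ^ 2 := by
    simp only [S, Finset.card_product, hIcard, sq]
  have hcardW : (Finset.univ : Finset (Fin n → Fin L)).card = ∑ c' ∈ S, (fib c').card :=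
    Finset.card_eq_sum_card_fiberwise fun w _ => hmaps w
  have hbound : L ^ n ≤ (fib c).card * (2 * n * R + 1) ^ 2 := by
    calc L ^ n = (Finset.univ : Finset (Fin n → Fin L)).card := by
          rw [Finset.card_univ, Fintype.card_fun, Fintype.card_fin, Fintype.card_fin]
      _ = ∑ c' ∈ S, (fib c').card := hcardW
      _ ≤ ∑ _c' ∈ S, (fib c).card := Finset.sum_le_sum hcmax
      _ = S.card * (fib c).card := by rw [Finset.sum_const, smul_eq_mul]
      _ = (fib c).card * (2 * n * R + 1) ^ 2 := by rw [hScard, mul_comm]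
  -- enumerate the popular class injectively
  let e : Fin (fib c).card ≃ {w // w ∈ fib c} := (fib c).equivFin.symm
  let word : Fin (fib c).card → (Fin n → Fin L) := fun i => (e i).1
  have hword_inj : Function.Injective word := fun i j h => e.injective (Subtype.ext h)
  have hword_cls : ∀ i, cls (word i) = c := fun i => (Finset.mem_filter.1 (e i).2).2
  refine ⟨(fib c).card, fun i => Fintype.piFinset fun t => A (word i t),
    fun i => Fintype.piFinset fun t => B (word i t), fun i => Fintype.piFinset fun t => C (word i t),
    ?_, ?_, hbound⟩
  · -- the product blocks of one class form an STPP family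
    intro i j k s hs s' hs' t ht t' ht' u hu u' hu' h0
    simp only [Fintype.mem_piFinset] at hs hs' ht ht' hu hu'
    have h0t : ∀ r, (s' r - s r) + (t' r - t r) + (u' r - u r) = 0 := fun r => by
      have := congrFun h0 r
      simpa using this
    -- coordinate weights
    let wt : Fin n → ℤ := fun r => (κ (word i r) - κ (word k r)) + (μ (word j r) - μ (word k r))
    have hdiag_or : ∀ r, (word i r = word j r ∧ word j r = word k r) ∨ 1 ≤ wt r := by
      intro r
      by_cases hd : word i r = word j r ∧ word j r = word k r
      · exact Or.inl hd
      · exact Or.inr (h5 (word i r) (word j r) (word k r) hd (s r) (hs r) (s' r) (hs' r) (t r)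
          (ht r) (t' r) (ht' r) (u r) (hu r) (u' r) (hu' r) (h0t r))
    have hnonneg : ∀ r, 0 ≤ wt r := by
      intro r
      rcases hdiag_or r with ⟨hij, hjk⟩ | h
      · have : wt r = 0 := by simp only [wt, hij, hjk]; ring
        rw [this]
      · omega
    have hsum : ∑ r, wt r = 0 := by
      have hi := hword_cls i
      have hj := hword_cls j
      have hk := hword_cls k
      simp only [cls, Prod.ext_iff] at hi hj hk
      have : ∑ r, wt r = (∑ r, κ (word i r) - ∑ r, κ (word k r)) +
          (∑ r, μ (word j r) - ∑ r, μ (word k r)) := by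
        simp only [wt, Finset.sum_add_distrib, Finset.sum_sub_distrib]
      rw [this, hi.1, hk.1, hj.2, hk.2]
      ring
    have hall : ∀ r, wt r = 0 := fun r =>
      (Finset.sum_eq_zero_iff_of_nonneg fun r _ => hnonneg r).1 hsum r (Finset.mem_univ r)
    have hdiag : ∀ r, word i r = word j r ∧ word j r = word k r := by
      intro r
      rcases hdiag_or r with hd | h
      · exact hd
      · have := hall r
        omega
    have hij : i = j := hword_inj (funext fun r => (hdiag r).1)
    have hjk : j = k := hword_inj (funext fun r => (hdiag r).2)
    subst hij
    subst hjk
    refine ⟨rfl, rfl, ?_, ?_, ?_⟩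
    · funext r
      exact (h4 (word i r) (s r) (hs r) (s' r) (hs' r) (t r) (ht r) (t' r) (ht' r) (u r) (hu r)
        (u' r) (hu' r) (h0t r)).1
    · funext r
      exact (h4 (word i r) (s r) (hs r) (s' r) (hs' r) (t r) (ht r) (t' r) (ht' r) (u r) (hu r)
        (u' r) (hu' r) (h0t r)).2.1
    · funext r
      exact (h4 (word i r) (s r) (hs r) (s' r) (hs' r) (t r) (ht r) (t' r) (ht' r) (u r) (hu r)
        (u' r) (hu' r) (h0t r)).2.2
  · -- cardinalities `Nⁿ, Mⁿ, Nⁿ`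
    intro i
    simp only [Fintype.card_piFinset, (hc _).1, (hc _).2.1, (hc _).2.2, Finset.prod_const,
      Finset.card_univ, Fintype.card_fin, and_self]

end Summit.MatrixMultiplication.MatrixMultiplication.Cruxes.ThinPackings.Drefute
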